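import Mathlib
import HarnessLib
import Summits.ValiantsHypothesis.ValiantsHypothesis.Theorems.LacunarySymmetroidMatrixDescartesProductPlusOnePivotWindow

/-!
# ValiantsHypothesis / LacunarySymmetroid — crux `MatrixDescartes` (stmt-ValiantsHypothesis-18050, V1),
# LINE (A) «product_plus_one»: the CELL COUNT — a window cut into `n` pivotable cells carries at most `n` zeros (every `K`, every coupling)

How the pivot window law ✓ `eulerNumeratorK_roots_Icc_le_one_of_pivot` (`…ProductPlusOnePivotWindow`) is used for COUNTING.  Along a constant-sign
window every letter-fraction sum `A_l` is monotone, so each letter flips from passed- to ahead-dominated at most once: the window is a chain of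
cells of constant dominance pattern.  Cutting the window at points `c 0 ≤ c 1 ≤ ⋯ ≤ c n` such that every cell `[c i, c (i+1)]` admits a pivot
(its pattern is threshold-shaped), the c-free Euler numerator has at most ONE zero per cell, hence at most `n` in the window.  The cells WITHOUT a
pivot (inversion cells, ✓ `…InversionLaw`) are the research residue and are not counted here.

* `card_filter_Icc_le_of_cells` — pure bookkeeping: a finite set of reals with at most one point in each cell `[c i, c (i+1)]` (`i < n`, `n ≥ 1`) has at most `n` points in `[c 0, c n]`;
* ★★ `eulerNumeratorK_roots_Icc_le_of_pivotCells` — every `K`, any support, every coupling: split-signed rows, constant-sign window `[c 0, c n] ⊂ (0,∞)`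
  cut into `n ≥ 1` cells each admitting a pivot ⇒ `R_{l₀}` has at most `n` zeros in the window (at `K = 3`, bottom coupling, with the two cuts at the
  sign changes of `A₁`, `A₂` in the non-inverted order this is the «β-β-β window ⇒ ≤ 3» count).

HONEST FRAMING: counting wrapper; closes NO stub by name; NOT `OneChangeFloorK3`, `EulerBoundK3`, `ClassRowK3Linear`, `PPOPolyLaw`, `ProductPlusOneMDR`,
`MatrixDescartes`; `VP ≠ VNP` is NOT proved.  No definitions, no named facts, no sorry.

[folklore] Elementary; no citation needed.
-/

set_option linter.dupNamespace false

namespace Summit.ValiantsHypothesis.ValiantsHypothesis.Theorems.LacunarySymmetroidMatrixDescartes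

namespace ProductPlusOne

open Polynomial Finset
open scoped BigOperators

/-- **Cell bookkeeping**: at most one point of `S` in each cell `[c i, c (i+1)]` for `i < n` (`1 ≤ n`) ⇒ at most `n` points of `S`
in `[c 0, c n]`. [folklore] -/
theorem card_filter_Icc_le_of_cells (S : Finset ℝ) (c : ℕ → ℝ) :
    ∀ n : ℕ, 1 ≤ n → (∀ i, i < n → (S.filter (fun t => c i ≤ t ∧ t ≤ c (i + 1))).card ≤ 1) →
      (S.filter (fun t => c 0 ≤ t ∧ t ≤ c n)).card ≤ n := by
  classical
  intro n
  induction n with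
  | zero => intro h; exact absurd h (by norm_num)
  | succ n ih =>
    intro _ hcell
    rcases Nat.eq_zero_or_pos n with hn | hn
    · subst hn
      simpa using hcell 0 (by norm_num)
    · have h1 : (S.filter (fun t => c 0 ≤ t ∧ t ≤ c n)).card ≤ n :=
        ih hn (fun i hi => hcell i (Nat.lt_succ_of_lt hi))
      have h2 : (S.filter (fun t => c n ≤ t ∧ t ≤ c (n + 1))).card ≤ 1 := hcell n (Nat.lt_succ_self n)
      have hsub : S.filter (fun t => c 0 ≤ t ∧ t ≤ c (n + 1))
          ⊆ S.filter (fun t => c 0 ≤ t ∧ t ≤ c n) ∪ S.filter (fun t => c n ≤ t ∧ t ≤ c (n + 1)) := by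
        intro t ht
        rw [Finset.mem_filter] at ht
        rw [Finset.mem_union, Finset.mem_filter, Finset.mem_filter]
        rcases le_total t (c n) with h | h
        · exact Or.inl ⟨ht.1, ht.2.1, h⟩
        · exact Or.inr ⟨ht.1, h, ht.2.2⟩
      calc (S.filter (fun t => c 0 ≤ t ∧ t ≤ c (n + 1))).card
          ≤ (S.filter (fun t => c 0 ≤ t ∧ t ≤ c n) ∪ S.filter (fun t => c n ≤ t ∧ t ≤ c (n + 1))).card :=
            Finset.card_le_card hsub
        _ ≤ (S.filter (fun t => c 0 ≤ t ∧ t ≤ c n)).card + (S.filter (fun t => c n ≤ t ∧ t ≤ c (n + 1))).card :=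
            Finset.card_union_le _ _
        _ ≤ n + 1 := Nat.add_le_add h1 h2

/-- ★★ **THE CELL COUNT** (every `K`, any support, every coupling `l₀`).  Split-signed rows; cut points `c 0 ≤ ⋯ ≤ c n` (`c` monotone, `n ≥ 1`,
`0 < c 0`); every row keeps a constant sign on the window `[c 0, c n]`; and every cell `[c i, c (i+1)]` (`i < n`) admits a pivot letter in the
sense of the pivot window law.  Then the c-free Euler numerator `R_{l₀}` has at most `n` zeros in `[c 0, c n]`. [this file's theorem] -/
theorem eulerNumeratorK_roots_Icc_le_of_pivotCells {m K : ℕ} (d : Fin K → ℕ) (a : Fin m → Fin K → ℝ) (l₀ : Fin K)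
    (hlow : ∀ j l, d l < d l₀ → 0 ≤ a j l) (hup : ∀ j l, d l₀ < d l → a j l ≤ 0)
    (c : ℕ → ℝ) (hc : Monotone c) (hc0 : 0 < c 0) (n : ℕ) (hn : 1 ≤ n)
    (hsign : ∀ j, (∀ x ∈ Set.Icc (c 0) (c n), 0 < (∑ l, C (a j l) * X ^ (d l) : ℝ[X]).eval x) ∨
      (∀ x ∈ Set.Icc (c 0) (c n), (∑ l, C (a j l) * X ^ (d l) : ℝ[X]).eval x < 0))
    (hcells : ∀ i, i < n → ∃ lp : Fin K,
      (∀ x ∈ Set.Icc (c i) (c (i + 1)), ∀ l, d lp < d l →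
        (d l < d l₀ → 0 < ∑ j, a j l * (x ^ (d l₀) / (∑ l', C (a j l') * X ^ (d l') : ℝ[X]).eval x)) ∧
        (d l₀ < d l → ∑ j, a j l * (x ^ (d l₀) / (∑ l', C (a j l') * X ^ (d l') : ℝ[X]).eval x) < 0)) ∧
      (∀ x ∈ Set.Icc (c i) (c (i + 1)), ∀ l, d l < d lp →
        (d l < d l₀ → ∑ j, a j l * (x ^ (d l₀) / (∑ l', C (a j l') * X ^ (d l') : ℝ[X]).eval x) < 0) ∧
        (d l₀ < d l → 0 < ∑ j, a j l * (x ^ (d l₀) / (∑ l', C (a j l') * X ^ (d l') : ℝ[X]).eval x))) ∧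
      (∃ l, d l ≠ d lp ∧ d l ≠ d l₀)) :
    ((∑ j, (∑ l, C (a j l * ((d l : ℝ) - d l₀)) * X ^ (d l)) * ∏ i ∈ Finset.univ.erase j, (∑ l, C (a i l) * X ^ (d l))
        : ℝ[X]).roots.toFinset.filter (fun t => c 0 ≤ t ∧ t ≤ c n)).card ≤ n := by
  classical
  refine card_filter_Icc_le_of_cells _ c n hn (fun i hi => ?_)
  -- the cell `[c i, c (i+1)]` sits inside the window, so the rows keep their signs there
  have hci0 : 0 < c i := lt_of_lt_of_le hc0 (hc (Nat.zero_le i))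
  have hsub : Set.Icc (c i) (c (i + 1)) ⊆ Set.Icc (c 0) (c n) := fun x hx =>
    ⟨(hc (Nat.zero_le i)).trans hx.1, hx.2.trans (hc (Nat.succ_le_of_lt hi))⟩
  have hsign' : ∀ j, (∀ x ∈ Set.Icc (c i) (c (i + 1)), 0 < (∑ l, C (a j l) * X ^ (d l) : ℝ[X]).eval x) ∨
      (∀ x ∈ Set.Icc (c i) (c (i + 1)), (∑ l, C (a j l) * X ^ (d l) : ℝ[X]).eval x < 0) := by
    intro j
    rcases hsign j with h | h
    · exact Or.inl fun x hx => h x (hsub hx)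
    · exact Or.inr fun x hx => h x (hsub hx)
  obtain ⟨lp, habove, hbelow, hex⟩ := hcells i hi
  exact eulerNumeratorK_roots_Icc_le_one_of_pivot d a l₀ lp hlow hup hci0 hsign' habove hbelow hex

end ProductPlusOne

end Summit.ValiantsHypothesis.ValiantsHypothesis.Theorems.LacunarySymmetroidMatrixDescartes
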